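import Summits.AtomisticToContinuum.HydrodynamicLimit.Theorems.MourreKoopmanChargesStressStrongMixingStressFramework
import Summits.AtomisticToContinuum.HydrodynamicLimit.Theorems.AntiMazurCoboundariesCorrectorPressureDecayKiferWallGibbsSanity
import HarnessLib

/-!
# `StressStrongMixing` · line `birth`, stub F3 `stub_momentsAndPositivity`, static half (F3a):
# the generating cell observables are square integrable under every hard-sphere Gibbs state

Support file for the crux item stmt-AtomisticToContinuum-9584 (`StressStrongMixing`, route `MourreKoopmanCharges` of
`AtomisticToContinuum/HydrodynamicLimit`), line `birth`, registered helper `memLp_generators_of_isHardSphereGibbs`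
(the first conjunct of the registered stub `stub_momentsAndPositivity`):

  `∀ σ θ z > 0, ∀ μ, IsHardSphereGibbs σ z θ⁻¹ 0 μ → ∀ a ∈ range cellCharge ∪ {cellObs (v ↦ v⁰ v¹)}, MemLp a 2 μ`.

No smallness of `σ`, no translation invariance and no density hypothesis is used (not even `σ > 0`: the hard-core
indicator is only bounded by `1`).  Route (Alexander 1976 §2.1 / Ruelle 1969 §4.2, "all local polynomial moments of a
grand-canonical Gibbs state with Maxwellian momenta are finite"): for a linear statistic `A_f = Σ_{p ∈ ω} f(p)` of a
measurable one-particle function `f` supported over a bounded window `Λ` with `|f(q, v)| ≤ C (1 + ‖v‖)ⁿ`,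

* on a superposition `X = superposeIn Λ x Y` of `k` thrown points with ANY boundary condition `Y`, `A_f(X)` is an honest
  finite sum over the thrown points above `Λ`, so `|A_f(X)| ≤ C Σᵢ (1 + ‖vᵢ‖)ⁿ` and, by Cauchy–Schwarz,
  `A_f(X)² ≤ C² k Σᵢ (1 + ‖vᵢ‖)²ⁿ` (`abs_linStat_superposeIn_le`, `ofReal_linStat_superposeIn_sq_le`);
* under the `k`-particle a-priori law `m^{⊗k}`, `m = Leb|_Λ ⊗ 𝒩(u, θI)` (`maxwellPhaseMeasure θ⁻¹ u Λ`,
  `KiferCompactification.maxwellPhaseMeasure_inv_eq_prod_gaussMeasure`), one coordinate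
  has law `m(univ)^{k-1} m`, so `∫ Σᵢ (1 + ‖vᵢ‖)²ⁿ dm^{⊗k} ≤ k R^k` with `R = m(univ) + ∫ (1 + ‖v‖)²ⁿ dm < ∞`
  (Fernique / Gaussian moments, `IsGaussian.memLp_id`; `lintegral_comp_eval_pi_le`);
* dropping the hard-core indicator and the normalisation `w(Y) ≥ 1` of the specification `γ_Λ(·|Y) = W(·|Y)/w(Y)`,
  `∫ A_f² dγ_Λ(·|Y) ≤ C² Σₖ (zᵏ/k!) k² Rᵏ < ∞` UNIFORMLY in `Y` (`lintegral_sq_linStat_gibbsSpecMeasure_le`,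
  `tsum_ofReal_pow_div_factorial_mul_sq_mul_pow_lt_top`);
* the DLR equation for functions (`KiferCompactification.lintegral_eq_lintegral_gibbsSpecMeasure`) transports the bound
  to `μ`: `∫ A_f² dμ < ∞`, i.e. `MemLp A_f 2 μ` (`memLp_two_linStat_of_isHardSphereGibbs`); the six generators are the
  cell observables `cellObs h` of the unit cell with `|h(v)| ≤ (1 + ‖v‖)²` (`memLp_two_cellObs_of_isHardSphereGibbs`).

References: R. Alexander, Comm. Math. Phys. 49 (1976), §2.1 (2.1.1); D. Ruelle, *Statistical Mechanics* (1969), §4.2;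
H. Spohn, *Large Scale Dynamics of Interacting Particles* (1991), Part I §7.1.
-/

noncomputable section

open MeasureTheory ProbabilityTheory Filter Topology
open scoped InnerProductSpace ENNReal

namespace Summit.AtomisticToContinuum.HydrodynamicLimit.Theorems.MourreKoopmanChargesStressStrongMixing

open Literature.MathematicalPhysics.KineticTheory Literature.Analysis.FluidPDE
open Literature.Analysis.FunctionSpaces (PointConfig)
open Summit.AtomisticToContinuum.HydrodynamicLimit.Theorems.KiferCompactification (gibbsWeightMeasure gibbsSpecMeasure
  lintegral_eq_lintegral_gibbsSpecMeasure lintegral_gibbsWeightMeasure lintegral_gibbsSpecMeasure one_le_gibbsWeight_univ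
  sigmaFinite_maxwellPhaseMeasure mem_superposeIn_iff maxwellPhaseMeasure_inv_eq_prod_gaussMeasure)

/-! ### Linear statistics of a superposition: finite sums over the thrown points -/

section Superposition

variable {Λ : Set V3}

/-- Polynomial velocity domination forces a non-negative constant. [folklore] -/
theorem nonneg_of_abs_le_mul_one_add_norm_pow {α : Type*} [SeminormedAddCommGroup α] {g : α → ℝ} {C : ℝ} {n : ℕ}
    (hg : ∀ v, |g v| ≤ C * (1 + ‖v‖) ^ n) : 0 ≤ C := by
  have h := hg 0
  rw [norm_zero, add_zero, one_pow, mul_one] at h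
  exact (abs_nonneg _).trans h

/-- Only finitely many particles of a superposition `superposeIn Λ x Y` lie above the window `Λ` (they are thrown
points). [folklore] -/
theorem finite_coe_superposeIn_inter_prod {k : ℕ} (x : Fin k → V3 × V3) (Y : MarkedConfig) :
    (((superposeIn Λ x Y : MarkedConfig) : Set (V3 × V3)) ∩ Λ ×ˢ Set.univ).Finite :=
  (Set.finite_range x).subset fun p hp => by
    rcases (mem_superposeIn_iff Λ x Y p).1 hp.1 with ⟨hpx, -⟩ | ⟨-, hpc⟩
    · exact hpx
    · exact absurd hp.2.1 hpc

/-- **A linear statistic supported over `Λ` sees only the thrown points of a superposition**: if `f` vanishes off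
`Λ × ℝ³` and `|f(q, v)| ≤ g(v)`, then `|A_f(superposeIn Λ x Y)| ≤ Σᵢ g(vᵢ)` over ALL `k` thrown points, for every
boundary condition `Y`. [folklore] -/
theorem abs_linStat_superposeIn_le {f : V3 × V3 → ℝ} {g : V3 → ℝ} (hfg : ∀ p, |f p| ≤ g p.2)
    (hfΛ : ∀ p : V3 × V3, p.1 ∉ Λ → f p = 0) {k : ℕ} (x : Fin k → V3 × V3) (Y : MarkedConfig) :
    |linStat f (superposeIn Λ x Y)| ≤ ∑ i, g (x i).2 := by
  classical
  set t : Finset (V3 × V3) := (Finset.univ.image x).filter fun p => p.1 ∈ Λ with ht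
  have h1 : ((superposeIn Λ x Y : MarkedConfig) : Set (V3 × V3)) ∩ Function.support f ⊆ ↑t := by
    rintro p ⟨hp, hfp⟩
    have hpΛ : p.1 ∈ Λ := by
      by_contra h
      exact hfp (hfΛ p h)
    rcases (mem_superposeIn_iff Λ x Y p).1 hp with ⟨⟨i, rfl⟩, -⟩ | ⟨-, hpc⟩
    · rw [Finset.mem_coe, ht, Finset.mem_filter, Finset.mem_image]
      exact ⟨⟨i, Finset.mem_univ i, rfl⟩, hpΛ⟩
    · exact absurd hpΛ hpc
  have h2 : (↑t : Set (V3 × V3)) ⊆ ((superposeIn Λ x Y : MarkedConfig) : Set (V3 × V3)) := by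
    intro p hp
    rw [Finset.mem_coe, ht, Finset.mem_filter, Finset.mem_image] at hp
    obtain ⟨⟨i, -, rfl⟩, hpΛ⟩ := hp
    exact (mem_superposeIn_iff Λ x Y _).2 (Or.inl ⟨⟨i, rfl⟩, hpΛ⟩)
  have hg0 : ∀ p : V3 × V3, 0 ≤ g p.2 := fun p => (abs_nonneg _).trans (hfg p)
  rw [linStat_def, finsum_mem_eq_sum_of_subset f h1 h2]
  calc |∑ p ∈ t, f p| ≤ ∑ p ∈ t, |f p| := Finset.abs_sum_le_sum_abs _ _
    _ ≤ ∑ p ∈ t, g p.2 := Finset.sum_le_sum fun p _ => hfg p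
    _ ≤ ∑ p ∈ Finset.univ.image x, g p.2 :=
        Finset.sum_le_sum_of_subset_of_nonneg (Finset.filter_subset _ _) fun p _ _ => hg0 p
    _ ≤ ∑ i, g (x i).2 := Finset.sum_image_le_of_nonneg (f := fun p : V3 × V3 => g p.2) fun p _ => hg0 p

/-- **Cauchy–Schwarz on the thrown points**, in `ℝ≥0∞`: if `|f(q, v)| ≤ C (1 + ‖v‖)ⁿ` and `f` vanishes off `Λ × ℝ³`,
then `A_f(superposeIn Λ x Y)² ≤ C² · k · Σᵢ (1 + ‖vᵢ‖)²ⁿ`. [folklore] -/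
theorem ofReal_linStat_superposeIn_sq_le {f : V3 × V3 → ℝ} {C : ℝ} {n : ℕ}
    (hf : ∀ p : V3 × V3, |f p| ≤ C * (1 + ‖p.2‖) ^ n) (hfΛ : ∀ p : V3 × V3, p.1 ∉ Λ → f p = 0)
    {k : ℕ} (x : Fin k → V3 × V3) (Y : MarkedConfig) :
    ENNReal.ofReal (linStat f (superposeIn Λ x Y) ^ 2) ≤
      ENNReal.ofReal (C ^ 2) * ((k : ℝ≥0∞) * ∑ i, ENNReal.ofReal ((1 + ‖(x i).2‖) ^ (2 * n))) := by
  have h1 : |linStat f (superposeIn Λ x Y)| ≤ ∑ i, C * (1 + ‖(x i).2‖) ^ n :=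
    abs_linStat_superposeIn_le (g := fun v => C * (1 + ‖v‖) ^ n) hf hfΛ x Y
  have h2 : linStat f (superposeIn Λ x Y) ^ 2 ≤ (∑ i, C * (1 + ‖(x i).2‖) ^ n) ^ 2 := by
    rw [← sq_abs]
    exact pow_le_pow_left₀ (abs_nonneg _) h1 2
  have h3 : (∑ i, C * (1 + ‖(x i).2‖) ^ n) ^ 2 ≤ C ^ 2 * (k * ∑ i, (1 + ‖(x i).2‖) ^ (2 * n)) := by
    rw [← Finset.mul_sum, mul_pow]
    refine mul_le_mul_of_nonneg_left ?_ (sq_nonneg C)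
    calc (∑ i, (1 + ‖(x i).2‖) ^ n) ^ 2 ≤ (Finset.univ.card : ℝ) * ∑ i, ((1 + ‖(x i).2‖) ^ n) ^ 2 :=
          sq_sum_le_card_mul_sum_sq
      _ = k * ∑ i, (1 + ‖(x i).2‖) ^ (2 * n) := by
          rw [Finset.card_univ, Fintype.card_fin]
          congr 1
          refine Finset.sum_congr rfl fun i _ => ?_
          rw [← pow_mul, mul_comm]
  calc ENNReal.ofReal (linStat f (superposeIn Λ x Y) ^ 2)
      ≤ ENNReal.ofReal (C ^ 2 * (k * ∑ i, (1 + ‖(x i).2‖) ^ (2 * n))) := ENNReal.ofReal_le_ofReal (h2.trans h3)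
    _ = ENNReal.ofReal (C ^ 2) * ((k : ℝ≥0∞) * ∑ i, ENNReal.ofReal ((1 + ‖(x i).2‖) ^ (2 * n))) := by
        rw [ENNReal.ofReal_mul (sq_nonneg C), ENNReal.ofReal_mul (Nat.cast_nonneg k), ENNReal.ofReal_natCast,
          ENNReal.ofReal_sum_of_nonneg fun i _ => by positivity]

end Superposition

/-! ### One-particle integrals: the a-priori law `Leb|_Λ ⊗ 𝒩(u, θ I)` and its velocity moments -/

section APriori

/-- The velocity weight `(q, v) ↦ (1 + ‖v‖)ⁿ` is measurable (as an `ℝ≥0∞`-valued function). [folklore] -/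
theorem measurable_ofReal_one_add_norm_snd_pow (n : ℕ) :
    Measurable fun p : V3 × V3 => ENNReal.ofReal ((1 + ‖p.2‖) ^ n) :=
  ((continuous_const.add (continuous_norm.comp continuous_snd)).pow n).measurable.ennreal_ofReal

/-- `(1 + ‖v‖)ⁿ` is integrable under the Gaussian velocity law `𝒩(u, θ I)` (Fernique, `IsGaussian.memLp_id`). [folklore] -/
theorem integrable_one_add_norm_pow_gaussMeasure (u : V3) (θ : ℝ) (n : ℕ) :
    Integrable (fun v : V3 => (1 + ‖v‖) ^ n) (gaussMeasure u θ) := by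
  -- adapted from `integrable_one_add_norm_pow_of_isGaussian` (…MourreKoopmanChargesIdealGasNoDecay.lean)
  have h0 : MemLp (fun v : V3 => ‖v‖) (n : ℝ≥0∞) (gaussMeasure u θ) :=
    (IsGaussian.memLp_id (gaussMeasure u θ) n (ENNReal.natCast_ne_top n)).norm
  have h1 : MemLp (fun v : V3 => 1 + ‖v‖) (n : ℝ≥0∞) (gaussMeasure u θ) := (memLp_const (1 : ℝ)).add h0
  refine h1.integrable_norm_pow'.congr (ae_of_all _ fun v => ?_)
  change ‖1 + ‖v‖‖ ^ n = (1 + ‖v‖) ^ n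
  rw [Real.norm_of_nonneg (by positivity)]

/-- **Finiteness of the one-particle constants**: for a bounded window, the total mass `m(univ) = vol Λ` and the velocity
moment `∫ (1 + ‖v‖)ⁿ dm = vol Λ · E(1 + ‖𝒩(u, θI)‖)ⁿ` of the a-priori law `m = maxwellPhaseMeasure θ⁻¹ u Λ` are finite.
[folklore] -/
theorem maxwellPhaseMeasure_univ_add_lintegral_ne_top {θ : ℝ} (hθ : 0 < θ) (u : V3) {Λ : Set V3}
    (hΛb : Bornology.IsBounded Λ) (n : ℕ) :
    maxwellPhaseMeasure θ⁻¹ u Λ Set.univ +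
      ∫⁻ p, ENNReal.ofReal ((1 + ‖p.2‖) ^ n) ∂(maxwellPhaseMeasure θ⁻¹ u Λ) ≠ ∞ := by
  have hvol : volume Λ ≠ ∞ := hΛb.measure_lt_top.ne
  have hI : ∫⁻ v, ENNReal.ofReal ((1 + ‖v‖) ^ n) ∂(gaussMeasure u θ) ≠ ∞ :=
    (integrable_one_add_norm_pow_gaussMeasure u θ n).lintegral_lt_top.ne
  rw [maxwellPhaseMeasure_inv_eq_prod_gaussMeasure hθ u Λ]
  refine ENNReal.add_ne_top.2 ⟨?_, ?_⟩
  · rw [← Set.univ_prod_univ, Measure.prod_prod, Measure.restrict_apply_univ, measure_univ, mul_one]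
    exact hvol
  · rw [lintegral_prod _ (measurable_ofReal_one_add_norm_snd_pow n).aemeasurable]
    change ∫⁻ _q, ∫⁻ v, ENNReal.ofReal ((1 + ‖v‖) ^ n) ∂(gaussMeasure u θ) ∂((volume : Measure V3).restrict Λ) ≠ ∞
    rw [lintegral_const, Measure.restrict_apply_univ]
    exact ENNReal.mul_ne_top hI hvol

/-- **One coordinate of the `k`-particle a-priori law**: `∫ G(xᵢ) dm^{⊗k}(x) = m(univ)^{k-1} ∫ G dm ≤ Rᵏ` with
`R = m(univ) + ∫ G dm`. [folklore] -/
theorem lintegral_comp_eval_pi_le (m : Measure (V3 × V3)) [SigmaFinite m] {G : V3 × V3 → ℝ≥0∞} (hG : Measurable G)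
    {k : ℕ} (i : Fin k) :
    ∫⁻ x, G (x i) ∂(Measure.pi fun _ : Fin k => m) ≤ (m Set.univ + ∫⁻ p, G p ∂m) ^ k := by
  classical
  have hk : 1 ≤ k := Fin.pos i
  set R : ℝ≥0∞ := m Set.univ + ∫⁻ p, G p ∂m with hR
  calc ∫⁻ x, G (x i) ∂(Measure.pi fun _ : Fin k => m)
      = ∫⁻ p, G p ∂((Measure.pi fun _ : Fin k => m).map (Function.eval i)) :=
        (lintegral_map hG (measurable_pi_apply i)).symm
    _ = m Set.univ ^ (k - 1) * ∫⁻ p, G p ∂m := by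
        rw [Measure.pi_map_eval, lintegral_smul_measure, smul_eq_mul, Finset.prod_const,
          Finset.card_erase_of_mem (Finset.mem_univ i), Finset.card_univ, Fintype.card_fin]
    _ ≤ R ^ (k - 1) * R := by
        gcongr
        · exact le_self_add
        · exact le_add_self
    _ = R ^ k := by rw [← pow_succ, Nat.sub_add_cancel hk]

end APriori

/-! ### The `k`-particle term, the specification bound, the Gibbs bound -/

section Gibbs

variable {Λ : Set V3}

/-- **The `k`-particle term**: for `|f(q, v)| ≤ C (1 + ‖v‖)ⁿ` vanishing off `Λ × ℝ³` and any event `S` of thrown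
points (e.g. the hard core), `∫_S A_f(superposeIn Λ x Y)² dm^{⊗k}(x) ≤ C² · k · (k · Rᵏ)`, `R = m(univ) + ∫ (1 + ‖v‖)²ⁿ dm`.
[folklore] -/
theorem setLIntegral_pi_sq_linStat_superposeIn_le {f : V3 × V3 → ℝ} {C : ℝ} {n : ℕ}
    (hf : ∀ p : V3 × V3, |f p| ≤ C * (1 + ‖p.2‖) ^ n) (hfΛ : ∀ p : V3 × V3, p.1 ∉ Λ → f p = 0)
    (m : Measure (V3 × V3)) [SigmaFinite m] (k : ℕ) (Y : MarkedConfig) (S : Set (Fin k → V3 × V3)) :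
    ∫⁻ x in S, ENNReal.ofReal (linStat f (superposeIn Λ x Y) ^ 2) ∂(Measure.pi fun _ : Fin k => m) ≤
      ENNReal.ofReal (C ^ 2) * ((k : ℝ≥0∞) * ((k : ℝ≥0∞) *
        (m Set.univ + ∫⁻ p, ENNReal.ofReal ((1 + ‖p.2‖) ^ (2 * n)) ∂m) ^ k)) := by
  set G : V3 × V3 → ℝ≥0∞ := fun p => ENNReal.ofReal ((1 + ‖p.2‖) ^ (2 * n)) with hGdef
  have hG : Measurable G := measurable_ofReal_one_add_norm_snd_pow (2 * n)
  set P : Measure (Fin k → V3 × V3) := Measure.pi fun _ : Fin k => m with hP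
  calc ∫⁻ x in S, ENNReal.ofReal (linStat f (superposeIn Λ x Y) ^ 2) ∂P
      ≤ ∫⁻ x, ENNReal.ofReal (linStat f (superposeIn Λ x Y) ^ 2) ∂P := setLIntegral_le_lintegral S _
    _ ≤ ∫⁻ x, ENNReal.ofReal (C ^ 2) * ((k : ℝ≥0∞) * ∑ i, G (x i)) ∂P :=
        lintegral_mono fun x => ofReal_linStat_superposeIn_sq_le hf hfΛ x Y
    _ = ENNReal.ofReal (C ^ 2) * ((k : ℝ≥0∞) * ∑ i, ∫⁻ x, G (x i) ∂P) := by
        rw [lintegral_const_mul' _ _ ENNReal.ofReal_ne_top, lintegral_const_mul' _ _ (ENNReal.natCast_ne_top k),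
          lintegral_finsetSum Finset.univ (f := fun (i : Fin k) (x : Fin k → V3 × V3) => G (x i))
            fun i _ => hG.comp (measurable_pi_apply i)]
    _ ≤ ENNReal.ofReal (C ^ 2) * ((k : ℝ≥0∞) * ∑ _i : Fin k, (m Set.univ + ∫⁻ p, G p ∂m) ^ k) := by
        gcongr with i _
        exact lintegral_comp_eval_pi_le m hG i
    _ = _ := by rw [Finset.sum_const, Finset.card_univ, Fintype.card_fin, nsmul_eq_mul]

/-- `Σₖ (zᵏ/k!) k² Rᵏ < ∞` for `z ≥ 0` and `R < ∞` (`k² ≤ 4ᵏ`, so the sum is at most `e^{4zR}`). [folklore] -/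
theorem tsum_ofReal_pow_div_factorial_mul_sq_mul_pow_lt_top {z : ℝ} (hz : 0 ≤ z) {R : ℝ≥0∞} (hR : R ≠ ∞) :
    ∑' k : ℕ, ENNReal.ofReal (z ^ k / (Nat.factorial k)) * ((k : ℝ≥0∞) * ((k : ℝ≥0∞) * R ^ k)) < ∞ := by
  -- adapted from `KiferCompactification.tsum_ofReal_pow_div_factorial_mul_lt_top` (…KiferWallGibbsSanitySpec.lean)
  set r : ℝ := R.toReal with hr
  have hr0 : 0 ≤ r := ENNReal.toReal_nonneg
  have hRr : R = ENNReal.ofReal r := (ENNReal.ofReal_toReal hR).symm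
  have hle : ∀ k : ℕ, ENNReal.ofReal (z ^ k / (Nat.factorial k)) * ((k : ℝ≥0∞) * ((k : ℝ≥0∞) * R ^ k)) ≤
      ENNReal.ofReal ((4 * z * r) ^ k / (Nat.factorial k)) := fun k => by
    rw [hRr, ← ENNReal.ofReal_pow hr0, ← ENNReal.ofReal_natCast, ← ENNReal.ofReal_mul (Nat.cast_nonneg k),
      ← ENNReal.ofReal_mul (Nat.cast_nonneg k), ← ENNReal.ofReal_mul (by positivity)]
    refine ENNReal.ofReal_le_ofReal ?_
    have hk : (k : ℝ) ≤ 2 ^ k := by exact_mod_cast Nat.lt_two_pow_self.le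
    have hk2 : (k : ℝ) * k ≤ 4 ^ k := by
      calc (k : ℝ) * k ≤ 2 ^ k * 2 ^ k := mul_le_mul hk hk (Nat.cast_nonneg k) (by positivity)
        _ = 4 ^ k := by rw [← mul_pow]; norm_num
    rw [div_mul_eq_mul_div, mul_pow, mul_pow]
    refine div_le_div_of_nonneg_right ?_ (by positivity)
    calc z ^ k * (k * (k * r ^ k)) = (k * k) * (z ^ k * r ^ k) := by ring
      _ ≤ 4 ^ k * (z ^ k * r ^ k) := by gcongr
      _ = 4 ^ k * z ^ k * r ^ k := by ring
  refine lt_of_le_of_lt (ENNReal.tsum_le_tsum hle) ?_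
  rw [← ENNReal.ofReal_tsum_of_nonneg (fun k => by positivity) (Real.summable_pow_div_factorial _)]
  exact ENNReal.ofReal_lt_top

/-- **The specification bound, uniform in the boundary condition**: for measurable `f` with `|f(q, v)| ≤ C (1 + ‖v‖)ⁿ`
vanishing off the measurable window `Λ`, and every boundary condition `Y`,
`∫ A_f² dγ_Λ(·|Y) ≤ C² Σₖ (zᵏ/k!) k² Rᵏ`, `R = m(univ) + ∫ (1 + ‖v‖)²ⁿ dm`, `m = maxwellPhaseMeasure β u Λ` (the hard-core
indicator is dropped and the normalising weight is `≥ 1`). [folklore] -/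
theorem lintegral_sq_linStat_gibbsSpecMeasure_le (ε z β : ℝ) (u : V3) (hΛ : MeasurableSet Λ)
    {f : V3 × V3 → ℝ} (hfm : Measurable f) {C : ℝ} {n : ℕ}
    (hf : ∀ p : V3 × V3, |f p| ≤ C * (1 + ‖p.2‖) ^ n) (hfΛ : ∀ p : V3 × V3, p.1 ∉ Λ → f p = 0) (Y : MarkedConfig) :
    ∫⁻ X, ENNReal.ofReal (linStat f X ^ 2) ∂(gibbsSpecMeasure ε z β u Λ Y) ≤
      ENNReal.ofReal (C ^ 2) * ∑' k : ℕ, ENNReal.ofReal (z ^ k / (Nat.factorial k)) * ((k : ℝ≥0∞) * ((k : ℝ≥0∞) *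
        (maxwellPhaseMeasure β u Λ Set.univ +
          ∫⁻ p, ENNReal.ofReal ((1 + ‖p.2‖) ^ (2 * n)) ∂(maxwellPhaseMeasure β u Λ)) ^ k)) := by
  haveI := sigmaFinite_maxwellPhaseMeasure β u Λ
  set m : Measure (V3 × V3) := maxwellPhaseMeasure β u Λ with hm
  have hF : Measurable fun X : MarkedConfig => ENNReal.ofReal (linStat f X ^ 2) :=
    ((measurable_linStat hfm).pow_const 2).ennreal_ofReal
  rw [lintegral_gibbsSpecMeasure]
  calc (gibbsWeight ε z β u Λ Y Set.univ)⁻¹ *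
        ∫⁻ X, ENNReal.ofReal (linStat f X ^ 2) ∂(gibbsWeightMeasure ε z β u Λ Y)
      ≤ 1 * ∫⁻ X, ENNReal.ofReal (linStat f X ^ 2) ∂(gibbsWeightMeasure ε z β u Λ Y) :=
        mul_le_mul' (ENNReal.inv_le_one.2 (one_le_gibbsWeight_univ ε z β u Λ Y)) le_rfl
    _ = ∑' k : ℕ, ENNReal.ofReal (z ^ k / (Nat.factorial k)) *
          ∫⁻ x in {x | HardCoreIn ε Λ (superposeIn Λ x Y)}, ENNReal.ofReal (linStat f (superposeIn Λ x Y) ^ 2)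
            ∂(Measure.pi fun _ : Fin k => m) := by
        rw [one_mul, lintegral_gibbsWeightMeasure ε z β u hΛ Y hF]
    _ ≤ ∑' k : ℕ, ENNReal.ofReal (z ^ k / (Nat.factorial k)) * (ENNReal.ofReal (C ^ 2) * ((k : ℝ≥0∞) * ((k : ℝ≥0∞) *
          (m Set.univ + ∫⁻ p, ENNReal.ofReal ((1 + ‖p.2‖) ^ (2 * n)) ∂m) ^ k))) :=
        ENNReal.tsum_le_tsum fun k =>
          mul_le_mul' le_rfl (setLIntegral_pi_sq_linStat_superposeIn_le hf hfΛ m k Y _)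
    _ = _ := by
        rw [← ENNReal.tsum_mul_left]
        refine tsum_congr fun k => ?_
        ring

/-- **Second moments of local linear statistics under a hard-sphere Gibbs state** (activity `z ≥ 0`, inverse
temperature `θ⁻¹`, any drift, any diameter): for measurable `f` with `|f(q, v)| ≤ C (1 + ‖v‖)ⁿ` vanishing off a bounded
measurable window, `∫ A_f² dμ < ∞` — the DLR equation for functions and the uniform specification bound. [folklore] -/
theorem lintegral_sq_linStat_lt_top_of_isHardSphereGibbs {σ z θ : ℝ} (hz : 0 ≤ z) (hθ : 0 < θ) {u : V3}
    {μ : Measure MarkedConfig} (hμ : IsHardSphereGibbs σ z θ⁻¹ u μ)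
    (hΛ : MeasurableSet Λ) (hΛb : Bornology.IsBounded Λ)
    {f : V3 × V3 → ℝ} (hfm : Measurable f) {C : ℝ} {n : ℕ}
    (hf : ∀ p : V3 × V3, |f p| ≤ C * (1 + ‖p.2‖) ^ n) (hfΛ : ∀ p : V3 × V3, p.1 ∉ Λ → f p = 0) :
    ∫⁻ ω, ENNReal.ofReal (linStat f ω ^ 2) ∂μ < ∞ := by
  haveI := hμ.1
  have hF : Measurable fun X : MarkedConfig => ENNReal.ofReal (linStat f X ^ 2) :=
    ((measurable_linStat hfm).pow_const 2).ennreal_ofReal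
  set R : ℝ≥0∞ := maxwellPhaseMeasure θ⁻¹ u Λ Set.univ +
    ∫⁻ p, ENNReal.ofReal ((1 + ‖p.2‖) ^ (2 * n)) ∂(maxwellPhaseMeasure θ⁻¹ u Λ) with hR
  set B : ℝ≥0∞ := ENNReal.ofReal (C ^ 2) *
    ∑' k : ℕ, ENNReal.ofReal (z ^ k / (Nat.factorial k)) * ((k : ℝ≥0∞) * ((k : ℝ≥0∞) * R ^ k)) with hB
  have hRtop : R ≠ ∞ := maxwellPhaseMeasure_univ_add_lintegral_ne_top hθ u hΛb (2 * n)
  have hBtop : B < ∞ :=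
    ENNReal.mul_lt_top ENNReal.ofReal_lt_top (tsum_ofReal_pow_div_factorial_mul_sq_mul_pow_lt_top hz hRtop)
  rw [lintegral_eq_lintegral_gibbsSpecMeasure hμ hΛ hΛb hF.aemeasurable]
  calc ∫⁻ Y, ∫⁻ X, ENNReal.ofReal (linStat f X ^ 2) ∂(gibbsSpecMeasure σ z θ⁻¹ u Λ Y) ∂μ
      ≤ ∫⁻ _, B ∂μ := lintegral_mono fun Y => lintegral_sq_linStat_gibbsSpecMeasure_le σ z θ⁻¹ u hΛ hfm hf hfΛ Y
    _ = B := by rw [lintegral_const, measure_univ, mul_one]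
    _ < ∞ := hBtop

/-- **Local linear statistics of polynomial velocity growth are square integrable under every hard-sphere Gibbs state**
(`z ≥ 0`, `θ > 0`, any drift, any diameter, any bounded measurable window). [folklore] -/
theorem memLp_two_linStat_of_isHardSphereGibbs {σ z θ : ℝ} (hz : 0 ≤ z) (hθ : 0 < θ) {u : V3}
    {μ : Measure MarkedConfig} (hμ : IsHardSphereGibbs σ z θ⁻¹ u μ)
    (hΛ : MeasurableSet Λ) (hΛb : Bornology.IsBounded Λ)
    {f : V3 × V3 → ℝ} (hfm : Measurable f) {C : ℝ} {n : ℕ}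
    (hf : ∀ p : V3 × V3, |f p| ≤ C * (1 + ‖p.2‖) ^ n) (hfΛ : ∀ p : V3 × V3, p.1 ∉ Λ → f p = 0) :
    MemLp (linStat f) 2 μ := by
  rw [memLp_two_iff_integrable_sq (measurable_linStat hfm).aestronglyMeasurable]
  refine ⟨((measurable_linStat hfm).pow_const 2).aestronglyMeasurable, ?_⟩
  rw [hasFiniteIntegral_iff_ofReal (ae_of_all _ fun ω => sq_nonneg (linStat f ω))]
  exact lintegral_sq_linStat_lt_top_of_isHardSphereGibbs hz hθ hμ hΛ hΛb hfm hf hfΛ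

/-- **One-body cell observables of polynomial velocity growth are square integrable under every hard-sphere Gibbs
state**: `MemLp (cellObs h) 2 μ` for measurable `h` with `|h(v)| ≤ C (1 + ‖v‖)ⁿ` (all local polynomial moments of a
grand-canonical hard-sphere Gibbs state with Maxwellian momenta are finite). [folklore] -/
theorem memLp_two_cellObs_of_isHardSphereGibbs {σ z θ : ℝ} (hz : 0 ≤ z) (hθ : 0 < θ) {u : V3}
    {μ : Measure MarkedConfig} (hμ : IsHardSphereGibbs σ z θ⁻¹ u μ) {h : V3 → ℝ} (hm : Measurable h)
    {C : ℝ} {n : ℕ} (hh : ∀ v, |h v| ≤ C * (1 + ‖v‖) ^ n) : MemLp (cellObs h) 2 μ := by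
  have hC : 0 ≤ C := nonneg_of_abs_le_mul_one_add_norm_pow hh
  have e : (fun p : V3 × V3 => unitCell.indicator (fun _ => h p.2) p.1) =
      (Prod.fst ⁻¹' unitCell).indicator fun p => h p.2 := by
    funext p
    by_cases hp : p.1 ∈ unitCell
    · simp [hp]
    · simp [hp]
  change MemLp (linStat fun p : V3 × V3 => unitCell.indicator (fun _ => h p.2) p.1) 2 μ
  refine memLp_two_linStat_of_isHardSphereGibbs hz hθ hμ measurableSet_unitCell isBounded_unitCell ?_
    (C := C) (n := n) (fun p => ?_) (fun p hp => ?_)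
  · rw [e]
    exact (hm.comp measurable_snd).indicator (measurableSet_unitCell.preimage measurable_fst)
  · by_cases hp : p.1 ∈ unitCell
    · rw [Set.indicator_of_mem hp]
      exact hh p.2
    · rw [Set.indicator_of_notMem hp, abs_zero]
      positivity
  · exact Set.indicator_of_notMem hp _

end Gibbs

/-! ### The registered helper: the six generators are square integrable -/

/-- **Registered helper `memLp_generators_of_isHardSphereGibbs`** (static half F3a of stub `stub_momentsAndPositivity`,
line `birth` of `StressStrongMixing`): under every Gibbs state of the hard-sphere gas of diameter `σ`, activity `z`,
inverse temperature `θ⁻¹`, zero drift, the five cell charges and the kinetic shear stress of the unit cell are square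
integrable (their one-body densities grow at most quadratically in the velocity; `σ > 0` and `z > 0` are not needed
beyond `z ≥ 0`). [folklore] -/
theorem memLp_generators_of_isHardSphereGibbs :
    ∀ (σ θ z : ℝ), 0 < σ → 0 < θ → 0 < z → ∀ μ : Measure MarkedConfig, IsHardSphereGibbs σ z θ⁻¹ (0 : V3) μ →
      ∀ a ∈ Set.range cellCharge ∪ {cellObs fun v : V3 => v 0 * v 1}, MemLp a 2 μ := by
  intro σ θ z _ hθ hz μ hμ a ha
  rcases ha with ⟨i, rfl⟩ | ha
  · exact memLp_two_cellObs_of_isHardSphereGibbs hz.le hθ hμ (continuous_chargeFn i).measurable (C := 1) (n := 2)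
      fun v => by simpa only [one_mul] using abs_chargeFn_le i v
  · rw [Set.mem_singleton_iff.1 ha]
    exact memLp_two_cellObs_of_isHardSphereGibbs hz.le hθ hμ
      (show Continuous fun v : V3 => v 0 * v 1 by fun_prop).measurable abs_shearStress_le

end Summit.AtomisticToContinuum.HydrodynamicLimit.Theorems.MourreKoopmanChargesStressStrongMixing

end
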